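import Summits.Ventures.PercRepro.PuncturedLYMPavingIn
import Summits.Ventures.PercRepro.PuncturedLYMAllJDensity

/-!
# PercRepro — THE POINTED LINE OF S5 FOR EVERY PAVING MATROID WITH AT MOST ONE NONTRIVIAL HYPERPLANE (p10, gen 34)

The one-hyperplane theorem on an arbitrary ground set (PuncturedLYMPavingIn) applies to the DELETIONS of a
one-hyperplane matroid, so the gen-32/33 bridges run at one matroid:
* `isPaving_delete` — paving is preserved by the deletion of a point;
* `rk_gr_delete_of_oneHyperplane`, `isOneHyperplaneF_delete` — when `E ∖ p ⊄ H` the deletion `M ∖ p` is again paving of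
  rank `r` with the single nontrivial hyperplane `H ∖ p`; `isUniformF_delete_of_subset` — when `E ∖ p ⊆ H` (`H = E ∖ p`)
  the deletion is the uniform matroid of rank `r − 1` on `H`;
* **`normConsAt_delete_of_oneHyperplane`** — (NC) at every deletion (`r + 2 ≤ n ≤ 2r − 2`);
* `density_step_of_uniform`, `density_step_of_paving` — Theorem A's normalised step `(n − k)·P_k ≤ (k + 1)·P_{k+1}` is a
  binomial fact for every uniform matroid and for every paving matroid with `n + 2 ≤ 2r`;
* **the pointed line**: (H-gen) `upsetMirrorAt_of_oneHyperplane` / `sepMirrorAt_of_oneHyperplane`, (PM-flat)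
  `biIndepFlatSupAt_of_oneHyperplane`, (D-gen) `avoidRowUpsetAt_of_oneHyperplane` (`r + 1 ≤ n ≤ 2r − 2`); (H)
  `capMirrorAt_of_oneHyperplane`, `outCount_le_inCount_succ_of_oneHyperplane`, (C1″) `capLimitPlus_body_of_oneHyperplane`,
  (D) `avoidRowAt_of_oneHyperplane` at every point (`r + 2 ≤ n ≤ 2r − 2`) — all UNCONDITIONAL, no named fact.
Nothing here asserts (SP), (PAV) or (NC) in general.
-/

open scoped Matroid

namespace PercRepro.Cogirth

open Finset ThmH Skew

variable {α : Type} [DecidableEq α] {M : Matroid α} [M.Finite]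

/-- Paving is preserved by the deletion of a point. -/
theorem isPaving_delete (hp : IsPaving M) (p : α) : IsPaving (M ＼ ({p} : Set α)) := by
  intro X hX hXc
  rw [gr_delete] at hX
  have hXg : X ⊆ gr M := hX.trans (erase_subset p (gr M))
  have hpX : p ∉ X := fun h => (mem_erase.1 (hX h)).1 rfl
  rw [rk_delete hXg hpX]
  apply hp X hXg
  have h1 : rk (M ＼ ({p} : Set α)) (gr (M ＼ ({p} : Set α))) ≤ rk M (gr M) := by
    rw [gr_delete, rk_delete (erase_subset p (gr M)) (notMem_erase p (gr M))]
    exact rk_mono_of_subset (erase_subset p (gr M))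
  omega

/-- When `E ∖ p ⊄ H`, the deletion of `p` from a one-hyperplane matroid still has rank `r` (`r + 1 ≤ n`, `1 ≤ r`). -/
theorem rk_gr_delete_of_oneHyperplane {r : ℕ} {H : Finset α} (h1 : IsOneHyperplaneF M r H)
    (hr1 : r + 1 ≤ (gr M).card) (hr : 1 ≤ r) {p : α} (hp : p ∈ gr M) (hnot : ¬ (gr M).erase p ⊆ H) :
    rk (M ＼ ({p} : Set α)) (gr (M ＼ ({p} : Set α))) = r := by
  obtain ⟨hrk, -, -, -, hH⟩ := h1
  rw [gr_delete, rk_delete (erase_subset p (gr M)) (notMem_erase p (gr M))]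
  apply le_antisymm
  · rw [← hrk]
    exact rk_mono_of_subset (erase_subset p (gr M))
  · obtain ⟨z, hz, hzH⟩ := not_subset.1 hnot
    have hcard : r - 1 ≤ (((gr M).erase p).erase z).card := by
      rw [card_erase_of_mem hz, card_erase_of_mem hp]
      omega
    obtain ⟨T, hT, hTc⟩ := exists_subset_card_eq hcard
    have hzT : z ∉ T := fun h => (mem_erase.1 (hT h)).1 rfl
    have hSg : insert z T ⊆ (gr M).erase p := by
      rw [insert_subset_iff]
      exact ⟨hz, hT.trans (erase_subset z _)⟩
    have hSc : (insert z T).card = r := by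
      rw [card_insert_of_notMem hzT, hTc]
      omega
    have hSH : ¬ insert z T ⊆ H := fun h => hzH (h (mem_insert_self z T))
    have hSi : rk M (insert z T) = (insert z T).card := by
      by_contra hne
      exact hSH ((hH _ (hSg.trans (erase_subset p (gr M))) hSc).1 hne)
    calc r = (insert z T).card := hSc.symm
      _ = rk M (insert z T) := hSi.symm
      _ ≤ rk M ((gr M).erase p) := rk_mono_of_subset hSg

/-- When `E ∖ p ⊆ H`, the deletion of `p` from a one-hyperplane matroid is uniform (every `r`-subset of `H` is
dependent, so the deletion has rank at most `r − 1`, and every smaller set is independent). -/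
theorem isUniformF_delete_of_subset {r : ℕ} {H : Finset α} (h1 : IsOneHyperplaneF M r H) {p : α}
    (hsub : (gr M).erase p ⊆ H) : IsUniformF (M ＼ ({p} : Set α)) := by
  obtain ⟨hrk, hpav, -, -, hH⟩ := h1
  have hgr : gr (M ＼ ({p} : Set α)) ⊆ (gr M).erase p := by
    rw [gr_delete]
  have hrank : rk (M ＼ ({p} : Set α)) (gr (M ＼ ({p} : Set α))) + 1 ≤ r := by
    obtain ⟨B, hBg, hBc, hBi⟩ := exists_basis_finset (M := M ＼ ({p} : Set α))
    by_contra hcon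
    have hrB : r ≤ B.card := by omega
    obtain ⟨S, hSB, hSc⟩ := exists_subset_card_eq hrB
    have hSi : (M ＼ ({p} : Set α)).Indep (S : Set α) := hBi.subset (by exact_mod_cast hSB)
    rw [Matroid.delete_indep_iff] at hSi
    have hSg : S ⊆ gr M := ((hSB.trans hBg).trans hgr).trans (erase_subset p (gr M))
    have hSH : S ⊆ H := ((hSB.trans hBg).trans hgr).trans hsub
    exact (hH S hSg hSc).2 hSH ((indep_iff_rk_eq_card S).1 hSi.1)
  intro S hS hSc
  have hSg' : S ⊆ gr M := (hS.trans hgr).trans (erase_subset p (gr M))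
  have hpS : p ∉ S := fun h => (mem_erase.1 (hgr (hS h))).1 rfl
  rw [rk_delete hSg' hpS]
  apply hpav S hSg'
  rw [hrk]
  omega

/-- When `E ∖ p ⊄ H`, the deletion of `p` from a one-hyperplane matroid is one-hyperplane with `H ∖ p`
(`r + 1 ≤ n`, `1 ≤ r`). -/
theorem isOneHyperplaneF_delete {r : ℕ} {H : Finset α} (h1 : IsOneHyperplaneF M r H)
    (hr1 : r + 1 ≤ (gr M).card) (hr : 1 ≤ r) {p : α} (hp : p ∈ gr M) (hnot : ¬ (gr M).erase p ⊆ H) :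
    IsOneHyperplaneF (M ＼ ({p} : Set α)) r (H.erase p) := by
  have hrkd := rk_gr_delete_of_oneHyperplane h1 hr1 hr hp hnot
  obtain ⟨-, hpav, hHg, hHn, hH⟩ := h1
  refine ⟨hrkd, isPaving_delete hpav p, ?_, ?_, ?_⟩
  · rw [gr_delete]
    exact erase_subset_erase p hHg
  · rw [gr_delete, card_erase_of_mem hp]
    rcases Decidable.em (p ∈ H) with hpH | hpH
    · rw [card_erase_of_mem hpH]
      have := card_pos.2 ⟨p, hpH⟩
      omega
    · rw [erase_eq_of_notMem hpH]
      have hHsub : H ⊆ (gr M).erase p := by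
        intro x hx
        exact mem_erase.2 ⟨fun h => hpH (h ▸ hx), hHg hx⟩
      have hne : H ≠ (gr M).erase p := fun h => hnot (by rw [h])
      have := card_lt_card (Finset.ssubset_iff_subset_ne.2 ⟨hHsub, hne⟩)
      rw [card_erase_of_mem hp] at this
      omega
  · intro S hS hSc
    rw [gr_delete] at hS
    have hSg : S ⊆ gr M := hS.trans (erase_subset p (gr M))
    have hpS : p ∉ S := fun h => (mem_erase.1 (hS h)).1 rfl
    rw [rk_delete hSg hpS, hH S hSg hSc]
    constructor
    · intro hSH x hx
      exact mem_erase.2 ⟨fun h => hpS (h ▸ hx), hSH hx⟩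
    · intro hSH
      exact hSH.trans (erase_subset p H)

/-- **(NC) AT THE DELETION OF EVERY POINT OF A ONE-HYPERPLANE MATROID** with `r + 2 ≤ n ≤ 2r − 2`: uniform when
`E ∖ p ⊆ H`, one-hyperplane of rank `r` on `n − 1` points otherwise. -/
theorem normConsAt_delete_of_oneHyperplane {r : ℕ} {H : Finset α} (h1 : IsOneHyperplaneF M r H)
    (hr2 : r + 2 ≤ (gr M).card) (hn : (gr M).card + 2 ≤ 2 * r) {p : α} (hp : p ∈ gr M) :
    NormConsAt (M ＼ ({p} : Set α)) := by
  rcases Decidable.em ((gr M).erase p ⊆ H) with hsub | hnot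
  · exact normConsAt_of_uniform (isUniformF_delete_of_subset h1 hsub)
  · have hN := card_gr_delete (M := M) hp
    exact normConsAt_of_oneHyperplane' (isOneHyperplaneF_delete h1 (by omega) (by omega) hp hnot)
      (by rw [hN]; omega) (by rw [hN]; omega)

/-! ### Theorem A's normalised step for uniform and paving matroids -/

/-- **Theorem A's normalised step is a binomial fact for every uniform matroid** (`2k + 1 ≤ n`):
`(n − k)·P_k ≤ (k + 1)·P_{k+1}`. -/
theorem density_step_of_uniform (hu : IsUniformF M) {k : ℕ} (hk : 2 * k + 1 ≤ (gr M).card) :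
    ((gr M).card - k) * (biIndepSets M k).card ≤ (k + 1) * (biIndepSets M (k + 1)).card := by
  rcases Nat.lt_or_ge (k + rk M (gr M)) (gr M).card with hlt | hge
  · rw [biIndepSets_eq_empty_of_lt hlt, card_empty, mul_zero]
    exact Nat.zero_le _
  · have hfull : biIndepSets M (k + 1) = (gr M).powersetCard (k + 1) := by
      apply biIndepSets_eq_powersetCard_of_indep_of_indep
      · intro S hS hSc
        exact hu S hS (by omega)
      · intro S hS hSc
        exact hu S hS (by omega)
    have hle : (biIndepSets M k).card ≤ (gr M).card.choose k := by
      rw [← card_powersetCard k (gr M)]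
      apply card_le_card
      intro X hX
      rw [mem_powersetCard]
      exact ⟨(mem_biIndepSets.1 hX).1, (mem_biIndepSets.1 hX).2.1⟩
    have hch := Nat.choose_succ_right_eq (gr M).card k
    rw [hfull, card_powersetCard]
    calc ((gr M).card - k) * (biIndepSets M k).card
        ≤ ((gr M).card - k) * (gr M).card.choose k := Nat.mul_le_mul_left _ hle
      _ = (gr M).card.choose k * ((gr M).card - k) := mul_comm _ _
      _ = (gr M).card.choose (k + 1) * (k + 1) := hch.symm
      _ = (k + 1) * (gr M).card.choose (k + 1) := mul_comm _ _

/-- **Theorem A's normalised step is a binomial fact for every paving matroid with `n + 2 ≤ 2r`** (`2k + 1 ≤ n`):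
`(n − k)·P_k ≤ (k + 1)·P_{k+1}`. -/
theorem density_step_of_paving {r : ℕ} (hp : IsPaving M) (hrk : rk M (gr M) = r) (hn : (gr M).card + 2 ≤ 2 * r)
    {k : ℕ} (hk : 2 * k + 1 ≤ (gr M).card) :
    ((gr M).card - k) * (biIndepSets M k).card ≤ (k + 1) * (biIndepSets M (k + 1)).card := by
  rcases Nat.lt_or_ge (k + r) (gr M).card with hlt | hge
  · rw [biIndepSets_eq_empty_of_lt (by rw [hrk]; exact hlt), card_empty, mul_zero]
    exact Nat.zero_le _
  · have hfull : biIndepSets M (k + 1) = (gr M).powersetCard (k + 1) := by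
      apply biIndepSets_eq_powersetCard_of_indep_of_indep
      · intro S hS hSc
        exact rk_eq_card_of_card_lt_of_paving hp hrk hS (by omega)
      · intro S hS hSc
        exact rk_eq_card_of_card_lt_of_paving hp hrk hS (by omega)
    have hle : (biIndepSets M k).card ≤ (gr M).card.choose k := by
      rw [← card_powersetCard k (gr M)]
      apply card_le_card
      intro X hX
      rw [mem_powersetCard]
      exact ⟨(mem_biIndepSets.1 hX).1, (mem_biIndepSets.1 hX).2.1⟩
    have hch := Nat.choose_succ_right_eq (gr M).card k
    rw [hfull, card_powersetCard]
    calc ((gr M).card - k) * (biIndepSets M k).card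
        ≤ ((gr M).card - k) * (gr M).card.choose k := Nat.mul_le_mul_left _ hle
      _ = (gr M).card.choose k * ((gr M).card - k) := mul_comm _ _
      _ = (gr M).card.choose (k + 1) * (k + 1) := hch.symm
      _ = (k + 1) * (gr M).card.choose (k + 1) := mul_comm _ _

/-! ### The pointed line for one-hyperplane matroids -/

/-- **(H-gen) for every one-hyperplane matroid** with `r + 1 ≤ n ≤ 2r − 2` (closure form). -/
theorem upsetMirrorAt_of_oneHyperplane {r : ℕ} {H : Finset α} (h1 : IsOneHyperplaneF M r H)
    (hr1 : r + 1 ≤ (gr M).card) (hn : (gr M).card + 2 ≤ 2 * r) : UpsetMirrorAt M :=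
  upsetMirrorAt_of_normConsAt (normConsAt_of_oneHyperplane' h1 hr1 hn)

/-- **(H-gen) for every one-hyperplane matroid** with `r + 1 ≤ n ≤ 2r − 2` (separated-set form). -/
theorem sepMirrorAt_of_oneHyperplane {r : ℕ} {H : Finset α} (h1 : IsOneHyperplaneF M r H)
    (hr1 : r + 1 ≤ (gr M).card) (hn : (gr M).card + 2 ≤ 2 * r) : SepMirrorAt M :=
  sepMirrorAt_of_upsetMirrorAt (upsetMirrorAt_of_oneHyperplane h1 hr1 hn)

/-- **(PM-flat) for every one-hyperplane matroid** with `r + 1 ≤ n ≤ 2r − 2`: an injection `BI_k → BI_{n−k}` along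
flat containment for every `2k < n`. -/
theorem biIndepFlatSupAt_of_oneHyperplane {r : ℕ} {H : Finset α} (h1 : IsOneHyperplaneF M r H)
    (hr1 : r + 1 ≤ (gr M).card) (hn : (gr M).card + 2 ≤ 2 * r) : BiIndepFlatSupAt M :=
  flatSupAt_of_flatSupHallAt (flatSupHallAt_of_upsetMirrorAt (upsetMirrorAt_of_oneHyperplane h1 hr1 hn))

/-- **(H) at every point of every one-hyperplane matroid** with `r + 2 ≤ n ≤ 2r − 2`: (H-gen) at the deletion `M ∖ p`
applied to the modular cut of `p`. -/
theorem capMirrorAt_of_oneHyperplane {r : ℕ} {H : Finset α} (h1 : IsOneHyperplaneF M r H)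
    (hr2 : r + 2 ≤ (gr M).card) (hn : (gr M).card + 2 ≤ 2 * r) {p : α} (hp : p ∈ gr M) : CapMirrorAt M p := by
  intro k hk
  have hN := card_gr_delete (M := M) hp
  have hsep := sepMirrorAt_of_upsetMirrorAt
    (upsetMirrorAt_of_normConsAt (normConsAt_delete_of_oneHyperplane h1 hr2 hn hp))
  have h2 := hsep (modCut M p) (upFlats_modCut p) k (by rw [hN]; omega)
  rw [hN, ← capCount_eq_sepCount_delete_modCut hp, ← capCount_eq_sepCount_delete_modCut hp,
    show (gr M).card - 1 - k = (gr M).card - (k + 1) by omega] at h2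
  exact h2

/-- The per-point form `out_k ≤ in_{k+1}` of Theorem A at every point of every one-hyperplane matroid with
`r + 2 ≤ n ≤ 2r − 2` (`2k + 2 ≤ n`). -/
theorem outCount_le_inCount_succ_of_oneHyperplane {r : ℕ} {H : Finset α} (h1 : IsOneHyperplaneF M r H)
    (hr2 : r + 2 ≤ (gr M).card) (hn : (gr M).card + 2 ≤ 2 * r) {p : α} (hp : p ∈ gr M) {k : ℕ}
    (hk : 2 * k + 2 ≤ (gr M).card) : outCount M k p ≤ inCount M (k + 1) p :=
  (outCount_le_inCount_succ_iff hp (by omega)).2 (capMirrorAt_of_oneHyperplane h1 hr2 hn hp k hk)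

/-- **(C1″) at every point of every one-hyperplane matroid** with `r + 2 ≤ n ≤ 2r − 2`. -/
theorem capLimitPlus_body_of_oneHyperplane {r : ℕ} {H : Finset α} (h1 : IsOneHyperplaneF M r H)
    (hr2 : r + 2 ≤ (gr M).card) (hn : (gr M).card + 2 ≤ 2 * r) {p : α} (hp : p ∈ gr M) :
    ((gr M).card - 1) * ∑ k ∈ range ((gr M).card + 1), capCount M k p ≤
      2 * ∑ k ∈ range ((gr M).card + 1), k * capCount M k p :=
  capLimitPlus_body_of_capMirrorAt hp (capMirrorAt_of_oneHyperplane h1 hr2 hn hp)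

/-- **(D-gen) for every one-hyperplane matroid** with `r + 1 ≤ n ≤ 2r − 2`. -/
theorem avoidRowUpsetAt_of_oneHyperplane {r : ℕ} {H : Finset α} (h1 : IsOneHyperplaneF M r H)
    (hr1 : r + 1 ≤ (gr M).card) (hn : (gr M).card + 2 ≤ 2 * r) : AvoidRowUpsetAt M :=
  avoidRowUpsetAt_of_normConsAt_of_step (fun _ hk => density_step_of_paving h1.2.1 h1.1 hn hk)
    (normConsAt_of_oneHyperplane' h1 hr1 hn)

/-- **(D-gen) at the deletion of every point of a one-hyperplane matroid** with `r + 2 ≤ n ≤ 2r − 2`. -/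
theorem avoidRowUpsetAt_delete_of_oneHyperplane {r : ℕ} {H : Finset α} (h1 : IsOneHyperplaneF M r H)
    (hr2 : r + 2 ≤ (gr M).card) (hn : (gr M).card + 2 ≤ 2 * r) {p : α} (hp : p ∈ gr M) :
    AvoidRowUpsetAt (M ＼ ({p} : Set α)) := by
  rcases Decidable.em ((gr M).erase p ⊆ H) with hsub | hnot
  · have hu := isUniformF_delete_of_subset h1 hsub
    exact avoidRowUpsetAt_of_normConsAt_of_step (fun _ hk => density_step_of_uniform hu hk)
      (normConsAt_of_uniform hu)
  · have hN := card_gr_delete (M := M) hp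
    have h1' := isOneHyperplaneF_delete h1 (by omega) (by omega) hp hnot
    exact avoidRowUpsetAt_of_normConsAt_of_step
      (fun _ hk => density_step_of_paving h1'.2.1 h1'.1 (by rw [hN]; omega) hk)
      (normConsAt_of_oneHyperplane' h1' (by rw [hN]; omega) (by rw [hN]; omega))

/-- **(D) at every point of every one-hyperplane matroid** with `r + 2 ≤ n ≤ 2r − 2`:
`(n − k − 1)·out_k ≤ (k + 1)·out_{k+1}` for `2k + 2 ≤ n`. -/
theorem avoidRowAt_of_oneHyperplane {r : ℕ} {H : Finset α} (h1 : IsOneHyperplaneF M r H)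
    (hr2 : r + 2 ≤ (gr M).card) (hn : (gr M).card + 2 ≤ 2 * r) {p : α} (hp : p ∈ gr M) : AvoidRowAt M p := by
  intro k hk
  have hN := card_gr_delete (M := M) hp
  have h2 := avoidRowUpsetAt_delete_of_oneHyperplane h1 hr2 hn hp (modCut M p) (upFlats_modCut p) k
    (by rw [hN]; omega)
  rw [avoidUpCount_modCut_eq_outCount hp, avoidUpCount_modCut_eq_outCount hp, hN] at h2
  rwa [show (gr M).card - k - 1 = (gr M).card - 1 - k by omega]

end PercRepro.Cogirth
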